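import Summits.QuantumFields.YangMills.Theorems.WeakCouplingRatesBoxCutoff
import Summits.QuantumFields.YangMills.Theorems.WeakCouplingRatesColdBoxDirichletWick
import Summits.QuantumFields.YangMills.Theorems.WeakCouplingRatesColdBoxForestGauge
import Summits.QuantumFields.YangMills.Theorems.WeakCouplingRatesColdBoxIndex
import Literature.MathematicalPhysics.QuantumFieldTheory.ChatterjeeFreeEnergyBounds

/-!
# Route `WeakCouplingRates`, crux `ColdBoxTwoPointFloorW` (stmt-QuantumFields-19608): the temporal-gauge DIRICHLET box kernel as a
# projection — forest gauge, Hodge split with a cut-off potential, comparison with error (S3c-iii content)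

Helper file (fleet seat `ym-wcr-19608-p2`; line `birth`).  The Dirichlet companion of `Theorems/WeakCouplingRatesBoxHodge.lean`: the
Gaussian `boxDirichlet H` of D1' (`Theorems/WeakCouplingRatesDefs.lean`) has two-point function `λ^D_p · Q_D⁻¹ λ^D_q`
(`integral_dirCirc_mul`, `…ColdBoxDirichletWick.lean`; `Q_D` positive definite, `posDef_dirQmat`), the kernel of the orthogonal
projection of `ℝ^{plaquettes of the enlarged box}` onto the curls of edge functions supported on the free Dirichlet edges.

* `sum_div₃_mul_coeff_shift_eq_zero` — divergences of 3-chains inside the cold box are orthogonal to the curls of ANY pinned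
  translated box containing its plaquettes (summation by parts `LatticeChain.pair₂_div₃`, `LatticeForm.d₂_d₁`);
* `exists_dirFree_curl_eq` — **forest gauge**: an edge function supported on the cold-box edges has, on every plaquette, the curl
  of the glued function of some free Dirichlet values (`forestFix` of `…ColdBoxForestGauge.lean` in the group `Multiplicative ℝ`);
* `d₁_smul_site`, `pointMass_eq_dir_split` — Leibniz formula for the cut-off potential and the split
  `δ_q = d₁(χφ_q) + div₃(χW_q) + [d₁((1−χ)φ_q) + div₃((1−χ)W_q)]`, `φ_q = div₂ g_q`, `W_q = d₂ g_q` (`greenTensor`);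
* `abs_dirKernel_sub_curl_le` — **comparison with error**: for plaquette labels `p, q` of the enlarged box and a cut-off `χ`
  supported in the inner cold box, `|λ^D_P·Q_D⁻¹λ^D_Q − d₁(χφ_Q)(P)| ≤ Σ_{p'}|d₁(χφ_P)(a+p')|·|V_Q(a+p')| + ‖V_P‖‖V_Q‖`
  (`P = a+p`, `Q = a+q`, `a = dirCorner`), fed by the projection algebra `abs_gramKernel_sub_le`.

No sorry, standard axioms; no new definition.  NOT a claim about the mass gap.
-/

set_option autoImplicit false

noncomputable section

open Finset Matrix
open Literature.Probability.LatticeModels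
open Literature.MathematicalPhysics.QuantumLattice
open Literature.MathematicalPhysics.QuantumFieldTheory
open Literature.MathematicalPhysics.QuantumFieldTheory.LatticeMaxwell
open Literature.MathematicalPhysics.QuantumFieldTheory.AxialGauge
open Literature.MathematicalPhysics.QuantumFieldTheory.LatticeChain
open Literature.MathematicalPhysics.QuantumFieldTheory.LatticeForm (e d₀ d₁ d₂ d₁_d₀ d₂_d₁ d₁_swap d₁_sub)

namespace Summit.QuantumFields.YangMills.Theorems.WeakCouplingRates

/-! ## Curls of glued edge functions for a general pinned Gaussian -/

section General

variable {pin : Literature.MathematicalPhysics.QuantumLattice.ZdEdge 4 → Prop} [DecidablePred pin]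
  {a : Site 4} {n : ℕ}

/-- `λ_p · s = sCirc (glue 0 s) p` for any pinned set and corner. -/
theorem coeff_dotProduct_eq_sCirc_gen (s : LatticeMaxwell.Free pin a n → ℝ) (p : Plaq 4) :
    coeff pin a n p ⬝ᵥ s = sCirc (LatticeMaxwell.glue (pin := pin) a n 0 s) p := by
  rw [sCirc_glue, bterm]
  have : sCirc (LatticeMaxwell.glue (pin := pin) a n (0 : Literature.MathematicalPhysics.QuantumLattice.ZdEdge 4 → ℝ)
      (0 : LatticeMaxwell.Free pin a n → ℝ)) p = 0 := by
    simp [sCirc, glue_zero_eq_sum]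
  rw [this, add_zero]

/-- Reindexing a sum over the plaquette labels of the translated box by the physical plaquettes. -/
theorem sum_shift_eq {β : Type*} [AddCommMonoid β] (F : Plaq 4 → β) :
    ∑ p ∈ plaquettesIn (halfOpenBox 4 n), F (Plaq.shift a p) =
      ∑ p ∈ plaquettesIn ((halfOpenBox 4 n).image (· + a)), F p := by
  rw [Plaq.plaquettesIn_image_add, Finset.sum_image]
  intro p _ q _ h
  exact Plaq.shift_injective a h

/-- **Divergences of 3-chains are orthogonal to the curls of a general pinned box**: if the totally alternating, finitely
supported 3-tensor `R` lives on the inner sites of a box `{0,…,m-1}⁴` all of whose plaquettes are plaquettes of the translated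
box `a + {0,…,n-1}⁴`, then `Σ_p (div₃ R)(a+p) (λ_{a+p} · s) = 0` for every free edge function `s`. -/
theorem sum_div₃_mul_coeff_shift_eq_zero {m : ℕ} {R : Site 4 → Fin 4 → Fin 4 → Fin 4 → ℝ}
    (hR : IsAltR₃ R) (hfin : Function.HasFiniteSupport R) (hsupp : ∀ y i j k, R y i j k ≠ 0 → y ∈ halfOpenBox 4 (m - 1))
    (hΛ : plaquettesIn (halfOpenBox 4 m) ⊆ plaquettesIn ((halfOpenBox 4 n).image (· + a)))
    (s : LatticeMaxwell.Free pin a n → ℝ) :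
    ∑ p ∈ plaquettesIn (halfOpenBox 4 n),
      div₃ R (Plaq.shift a p).1 (Plaq.shift a p).2.1 (Plaq.shift a p).2.2 * (coeff pin a n (Plaq.shift a p) ⬝ᵥ s) = 0 := by
  set ψ : Site 4 → Fin 4 → ℝ := fun x i => LatticeMaxwell.glue (pin := pin) a n 0 s (x, i) with hψ
  have hcurl : ∀ p : Plaq 4, coeff pin a n p ⬝ᵥ s = d₁ ψ p.1 p.2.1 p.2.2 := fun p => by
    rw [coeff_dotProduct_eq_sCirc_gen, sCirc_eq_d₁]
  simp_rw [hcurl]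
  rw [sum_shift_eq (F := fun p : Plaq 4 => div₃ R p.1 p.2.1 p.2.2 * d₁ ψ p.1 p.2.1 p.2.2)]
  set Λ' := (halfOpenBox 4 n).image (· + a) with hΛ'
  have halt : IsAltR₂ (d₁ ψ) := fun y i j => d₁_swap ψ y i j
  have hsupp' : ∀ y k l, div₃ R y k l ≠ 0 → (y, k, l) ∈ plaquettesIn Λ' ∨ (y, l, k) ∈ plaquettesIn Λ' := by
    intro y k l h
    rcases div₃_support hR hsupp y k l h with h1 | h1
    · exact Or.inl (hΛ h1)
    · exact Or.inr (hΛ h1)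
  have hflux : fluxChain Λ' (ofChain Λ' (div₃ R)) = div₃ R := fluxChain_ofChain (isAltR₂_div₃ hR) hsupp'
  have hpair := pair₂_fluxChain_left (ofChain Λ' (div₃ R)) halt
  rw [hflux] at hpair
  have hsum : ∑ p ∈ plaquettesIn Λ', div₃ R p.1 p.2.1 p.2.2 * d₁ ψ p.1 p.2.1 p.2.2 =
      ∑ p : ↥(plaquettesIn Λ'), ofChain Λ' (div₃ R) p * d₁ ψ (p : Plaq 4).1 (p : Plaq 4).2.1 (p : Plaq 4).2.2 := by
    rw [← Finset.sum_coe_sort]; rfl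
  rw [hsum, ← hpair, pair₂_div₃ hfin hR, d₂_d₁]
  simp [pair₃]

end General

/-! ## The forest gauge: curls of edge functions supported on the cold box are Dirichlet curls -/

/-- **Gauge reduction to the temporal forest gauge.**  Every edge function `φ` supported on the edges of the cold box
`{0,…,2H}⁴` has the same curl, on EVERY plaquette, as the glued function of some free Dirichlet edge values `s`:
`λ^D_p · s = (d₁ φ)(p)` for all `p` (the tree's `forestFix` in the group `Multiplicative ℝ`). -/
theorem exists_dirFree_curl_eq (H : ℕ) (φ : Site 4 → Fin 4 → ℝ)
    (hφ : ∀ x i, φ x i ≠ 0 → (x, i) ∈ boxEdges 4 (2 * H + 1)) :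
    ∃ s : DirFree H → ℝ, ∀ p : Plaq 4,
      coeff (fun e => e ∉ dirFreeEdges H) dirCorner (2 * H + 3) p ⬝ᵥ s = d₁ φ p.1 p.2.1 p.2.2 := by
  classical
  set U : LGConfig 4 (Multiplicative ℝ) := fun e => Multiplicative.ofAdd (φ e.1 e.2) with hU
  set g : Site 4 → ℝ := fun x => Multiplicative.toAdd (forestGauge H U x) with hg
  set Ψ : Literature.MathematicalPhysics.QuantumLattice.ZdEdge 4 → ℝ := fun e => Multiplicative.toAdd (forestFix H U e) with hΨ
  have hΨ_eq : ∀ x i, Ψ (x, i) = (φ - d₀ g) x i := by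
    intro x i
    simp only [hΨ, hg, forestFix_apply, toAdd_mul, toAdd_inv, Pi.sub_apply, LatticeForm.d₀, LatticeForm.e, hU,
      toAdd_ofAdd]
    ring
  -- `g` vanishes off the interior, hence `d₀ g` is supported on box edges
  have hg0 : ∀ x : Site 4, ¬ (∀ k : Fin 4, 1 ≤ x k ∧ x k + 1 ≤ 2 * (H : ℤ)) → g x = 0 := by
    intro x hx
    simp only [hg, forestGauge_of_not_interior U hx, toAdd_one]
  have hint_mem : ∀ (x : Site 4) (i : Fin 4), (∀ k : Fin 4, 1 ≤ x k ∧ x k + 1 ≤ 2 * (H : ℤ)) →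
      (x, i) ∈ boxEdges 4 (2 * H + 1) ∧ (x - e i, i) ∈ boxEdges 4 (2 * H + 1) := by
    intro x i hx
    constructor
    · rw [mem_boxEdges_iff]
      refine ⟨fun k => ?_, ?_⟩
      · have := hx k; push_cast; omega
      · have := hx i; push_cast; omega
    · rw [mem_boxEdges_iff]
      refine ⟨fun k => ?_, ?_⟩
      · have := hx k
        simp only [Pi.sub_apply, LatticeForm.e, Pi.single_apply]
        split_ifs <;> push_cast <;> omega
      · have := hx i
        simp only [Pi.sub_apply, LatticeForm.e, Pi.single_eq_same]
        push_cast; omega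
  have hΨ_supp : ∀ x i, Ψ (x, i) ≠ 0 → (x, i) ∈ boxEdges 4 (2 * H + 1) := by
    intro x i h
    rw [hΨ_eq] at h
    simp only [Pi.sub_apply, LatticeForm.d₀] at h
    by_contra hmem
    apply h
    have h1 : φ x i = 0 := by
      by_contra h1; exact hmem (hφ x i h1)
    have h2 : g x = 0 := by
      by_contra h2
      have hx : ∀ k : Fin 4, 1 ≤ x k ∧ x k + 1 ≤ 2 * (H : ℤ) := by
        by_contra hx; exact h2 (hg0 x hx)
      exact hmem (hint_mem x i hx).1
    have h3 : g (x + e i) = 0 := by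
      by_contra h3
      have hx : ∀ k : Fin 4, 1 ≤ (x + e i) k ∧ (x + e i) k + 1 ≤ 2 * (H : ℤ) := by
        by_contra hx; exact h3 (hg0 _ hx)
      have := (hint_mem (x + e i) i hx).2
      rw [add_sub_cancel_right] at this
      exact hmem this
    rw [h1, h2, h3]; ring
  have hΨ_forest : ∀ x : Site 4, (∀ k : Fin 4, 1 ≤ x k ∧ x k + 1 ≤ 2 * (H : ℤ)) → Ψ (x, 0) = 0 := by
    intro x hx
    simp only [hΨ, forestFix_forest U hx, toAdd_one]
  have hΨ_zero : ∀ e : Literature.MathematicalPhysics.QuantumLattice.ZdEdge 4, e ∉ dirFreeEdges H → Ψ e = 0 := by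
    rintro ⟨x, i⟩ he
    rw [mem_dirFreeEdges, not_and_or, not_not] at he
    rcases he with he | he
    · by_contra h; exact he (hΨ_supp x i h)
    · obtain ⟨hi, hx⟩ := he
      simp only at hi
      subst hi
      exact hΨ_forest x (fun k => by have := hx k; exact ⟨this.1, by exact_mod_cast this.2⟩)
  refine ⟨fun e => Ψ e.1.1, fun p => ?_⟩
  rw [coeff_dotProduct_eq_sCirc_gen]
  -- the glued function IS `Ψ`, on every edge
  have hglue : ∀ e : Literature.MathematicalPhysics.QuantumLattice.ZdEdge 4,
      LatticeMaxwell.glue (pin := fun e => e ∉ dirFreeEdges H) dirCorner (2 * H + 3) 0 (fun e : DirFree H => Ψ e.1.1) e = Ψ e := by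
    intro e
    by_cases he : e ∈ boxEdgesAt dirCorner (2 * H + 3)
    · by_cases hp : e ∉ dirFreeEdges H
      · rw [glue_apply_pin _ _ he hp, hΨ_zero e hp]; rfl
      · exact glue_apply_free 0 _ ⟨⟨e, he⟩, hp⟩
    · rw [glue_apply_of_not_mem _ _ he]
      refine (hΨ_zero e fun hmem => he ?_).symm
      exact boxEdges_subset_boxEdgesAt_dirCorner H ((mem_dirFreeEdges.1 hmem).1)
  have hfun : LatticeMaxwell.glue (pin := fun e => e ∉ dirFreeEdges H) dirCorner (2 * H + 3) 0 (fun e : DirFree H => Ψ e.1.1) = Ψ :=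
    funext hglue
  rw [hfun, sCirc_eq_d₁]
  have : d₁ φ p.1 p.2.1 p.2.2 = d₁ (φ - d₀ g) p.1 p.2.1 p.2.2 := by rw [d₁_sub, d₁_d₀, sub_zero]
  rw [this]
  simp only [LatticeForm.d₁, LatticeForm.e, hΨ_eq]

/-! ## Leibniz for the cut-off potential and the decomposition of `δ_q` -/

/-- **Leibniz formula for the cut-off curl**:
`d₁(ρφ)(y;k,l) = ρ(y)·(d₁φ)(y;k,l) + (ρ(y+e_k) − ρ(y))·φ(y+e_k;l) − (ρ(y+e_l) − ρ(y))·φ(y+e_l;k)`. -/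
theorem d₁_smul_site (ρ : Site 4 → ℝ) (φ : Site 4 → Fin 4 → ℝ) (y : Site 4) (k l : Fin 4) :
    d₁ (fun x i => ρ x * φ x i) y k l =
      ρ y * d₁ φ y k l + (ρ (y + e k) - ρ y) * φ (y + e k) l - (ρ (y + e l) - ρ y) * φ (y + e l) k := by
  simp only [LatticeForm.d₁]; ring

/-- **The decomposition of the point mass for the Dirichlet problem**: for plaquettes `q`, `p'` (of positive orientation) and any
scalar `χ`, `δ_q(p') = d₁(χφ_q)(p') + div₃(χW_q)(p') + [d₁((1−χ)φ_q) + div₃((1−χ)W_q)](p')`, `φ_q = div₂ g_q`, `W_q = d₂ g_q`. -/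
theorem pointMass_eq_dir_split {q p' : Plaq 4} (hq : q.2.1 < q.2.2) (hp' : p'.2.1 < p'.2.2) (χ : Site 4 → ℝ) :
    (if p' = q then (1 : ℝ) else 0) =
      d₁ (fun x i => χ x * div₂ (greenTensor q) x i) p'.1 p'.2.1 p'.2.2 +
        div₃ (fun y a b c => χ y * d₂ (greenTensor q) y a b c) p'.1 p'.2.1 p'.2.2 +
        (d₁ (fun x i => (1 - χ x) * div₂ (greenTensor q) x i) p'.1 p'.2.1 p'.2.2 +
          div₃ (fun y a b c => (1 - χ y) * d₂ (greenTensor q) y a b c) p'.1 p'.2.1 p'.2.2) := by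
  have h := congrFun (congrFun (congrFun (d₁_div₂_add_div₃_d₂_greenTensor (by norm_num : 3 ≤ 4) q) p'.1) p'.2.1) p'.2.2
  simp only [Pi.add_apply] at h
  have hsplit₁ : d₁ (div₂ (greenTensor q)) p'.1 p'.2.1 p'.2.2 =
      d₁ (fun x i => χ x * div₂ (greenTensor q) x i) p'.1 p'.2.1 p'.2.2 +
        d₁ (fun x i => (1 - χ x) * div₂ (greenTensor q) x i) p'.1 p'.2.1 p'.2.2 := by
    simp only [LatticeForm.d₁]; ring
  have hsplit₂ := div₃_split χ (d₂ (greenTensor q)) p'.1 p'.2.1 p'.2.2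
  obtain ⟨y, k, l⟩ := p'
  obtain ⟨x, i, j⟩ := q
  have hswap : ¬ ((y, l, k) : Plaq 4) = (x, i, j) := by
    intro heq
    simp only [Prod.mk.injEq] at heq
    obtain ⟨-, rfl, rfl⟩ := heq
    exact lt_asymm hq hp'
  simp only at hsplit₁ hsplit₂ h ⊢
  rw [plaqChain] at h
  simp only [hswap, if_false, sub_zero] at h
  linarith

/-! ## The Dirichlet kernel as a projection: comparison with error -/

/-- The Dirichlet precision matrix is the Gram matrix of the circulation vectors over the plaquette labels of the enlarged box. -/
theorem dirQmat_eq_sum (H : ℕ) :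
    Qmat (fun e => e ∉ dirFreeEdges H) dirCorner (2 * H + 3) =
      ∑ p ∈ plaquettesIn (halfOpenBox 4 (2 * H + 3)),
        vecMulVec (coeff (fun e => e ∉ dirFreeEdges H) dirCorner (2 * H + 3) (Plaq.shift dirCorner p))
          (coeff (fun e => e ∉ dirFreeEdges H) dirCorner (2 * H + 3) (Plaq.shift dirCorner p)) := rfl

/-- The plaquettes of the cold box are plaquettes of the enlarged box. -/
theorem plaquettesIn_cold_subset_enlarged (H : ℕ) :
    plaquettesIn (halfOpenBox 4 (2 * H + 1)) ⊆ plaquettesIn ((halfOpenBox 4 (2 * H + 3)).image (· + dirCorner)) := by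
  refine ChatterjeeJointLimit.plaquettesIn_mono' fun x hx => ?_
  rw [Finset.mem_image]
  refine ⟨x - dirCorner, ?_, sub_add_cancel x dirCorner⟩
  rw [mem_halfOpenBox] at hx ⊢
  intro k
  have := hx k
  simp only [Pi.sub_apply, dirCorner]
  push_cast; omega

/-- **The Dirichlet kernel versus the `ℤ⁴` curl kernel, with error.**  For plaquette labels `p, q` of the enlarged box and any
scalar `χ` supported in the inner cold box `{0,…,2H−1}⁴`, writing `P = a + p`, `Q = a + q` (`a = dirCorner`) for the physical
plaquettes and `A_x = d₁(χ·div₂ g_x)`, `V_x = d₁((1−χ)·div₂ g_x) + div₃((1−χ)·d₂ g_x)`: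
`|λ^D_P·Q_D⁻¹λ^D_Q − A_Q(P)| ≤ Σ_{p'} |A_P(a+p')|·|V_Q(a+p')| + ‖V_P‖ ‖V_Q‖`. -/
theorem abs_dirKernel_sub_curl_le (H : ℕ) {p q : Plaq 4}
    (hp : p ∈ plaquettesIn (halfOpenBox 4 (2 * H + 3))) (hq : q ∈ plaquettesIn (halfOpenBox 4 (2 * H + 3)))
    {χ : Site 4 → ℝ} (hχ : ∀ y, χ y ≠ 0 → y ∈ halfOpenBox 4 (2 * H + 1 - 1)) :
    |coeff (fun e => e ∉ dirFreeEdges H) dirCorner (2 * H + 3) (Plaq.shift dirCorner p) ⬝ᵥ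
        (Qmat (fun e => e ∉ dirFreeEdges H) dirCorner (2 * H + 3))⁻¹ *ᵥ
          coeff (fun e => e ∉ dirFreeEdges H) dirCorner (2 * H + 3) (Plaq.shift dirCorner q) -
      d₁ (fun x i => χ x * div₂ (greenTensor (Plaq.shift dirCorner q)) x i)
        (Plaq.shift dirCorner p).1 (Plaq.shift dirCorner p).2.1 (Plaq.shift dirCorner p).2.2| ≤
      ∑ p' ∈ plaquettesIn (halfOpenBox 4 (2 * H + 3)),
          |d₁ (fun x i => χ x * div₂ (greenTensor (Plaq.shift dirCorner p)) x i)
              (Plaq.shift dirCorner p').1 (Plaq.shift dirCorner p').2.1 (Plaq.shift dirCorner p').2.2| *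
            |d₁ (fun x i => (1 - χ x) * div₂ (greenTensor (Plaq.shift dirCorner q)) x i)
                (Plaq.shift dirCorner p').1 (Plaq.shift dirCorner p').2.1 (Plaq.shift dirCorner p').2.2 +
              div₃ (fun y a b c => (1 - χ y) * d₂ (greenTensor (Plaq.shift dirCorner q)) y a b c)
                (Plaq.shift dirCorner p').1 (Plaq.shift dirCorner p').2.1 (Plaq.shift dirCorner p').2.2| +
        Real.sqrt (∑ p' ∈ plaquettesIn (halfOpenBox 4 (2 * H + 3)),
            (d₁ (fun x i => (1 - χ x) * div₂ (greenTensor (Plaq.shift dirCorner p)) x i)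
                (Plaq.shift dirCorner p').1 (Plaq.shift dirCorner p').2.1 (Plaq.shift dirCorner p').2.2 +
              div₃ (fun y a b c => (1 - χ y) * d₂ (greenTensor (Plaq.shift dirCorner p)) y a b c)
                (Plaq.shift dirCorner p').1 (Plaq.shift dirCorner p').2.1 (Plaq.shift dirCorner p').2.2) ^ 2) *
          Real.sqrt (∑ p' ∈ plaquettesIn (halfOpenBox 4 (2 * H + 3)),
            (d₁ (fun x i => (1 - χ x) * div₂ (greenTensor (Plaq.shift dirCorner q)) x i)
                (Plaq.shift dirCorner p').1 (Plaq.shift dirCorner p').2.1 (Plaq.shift dirCorner p').2.2 +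
              div₃ (fun y a b c => (1 - χ y) * d₂ (greenTensor (Plaq.shift dirCorner q)) y a b c)
                (Plaq.shift dirCorner p').1 (Plaq.shift dirCorner p').2.1 (Plaq.shift dirCorner p').2.2) ^ 2) := by
  set n := 2 * H + 3 with hn
  set pin : Literature.MathematicalPhysics.QuantumLattice.ZdEdge 4 → Prop := fun e => e ∉ dirFreeEdges H with hpin
  set P := Plaq.shift dirCorner p with hP
  set Q := Plaq.shift dirCorner q with hQ
  -- cut-off potentials are supported on cold-box edges, hence are Dirichlet curls
  have hsuppφ : ∀ (x : Plaq 4) (y : Site 4) (i : Fin 4), χ y * div₂ (greenTensor x) y i ≠ 0 → (y, i) ∈ boxEdges 4 (2 * H + 1) := by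
    intro x y i h
    have hy := hχ y (left_ne_zero_of_mul h)
    rw [Nat.add_sub_cancel, mem_halfOpenBox] at hy
    rw [mem_boxEdges_iff]
    refine ⟨fun k => ?_, ?_⟩
    · have := hy k; push_cast; omega
    · have := hy i; push_cast; omega
  obtain ⟨sq, hsq⟩ := exists_dirFree_curl_eq H (fun x i => χ x * div₂ (greenTensor Q) x i) (hsuppφ Q)
  obtain ⟨sp, hsp⟩ := exists_dirFree_curl_eq H (fun x i => χ x * div₂ (greenTensor P) x i) (hsuppφ P)
  have hK : ∀ p' q' : Plaq 4, (fun p' q' : Plaq 4 => coeff pin dirCorner n (Plaq.shift dirCorner p') ⬝ᵥ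
      (Qmat pin dirCorner n)⁻¹ *ᵥ coeff pin dirCorner n (Plaq.shift dirCorner q')) p' q' =
      coeff pin dirCorner n (Plaq.shift dirCorner p') ⬝ᵥ (Qmat pin dirCorner n)⁻¹ *ᵥ coeff pin dirCorner n (Plaq.shift dirCorner q') :=
    fun _ _ => rfl
  have hqor : Q.2.1 < Q.2.2 := (Plaq.mem_plaquettesIn.1 hq).2.1
  have hpor : P.2.1 < P.2.2 := (Plaq.mem_plaquettesIn.1 hp).2.1
  have hiffq : ∀ p' : Plaq 4, (Plaq.shift dirCorner p' = Q) ↔ (p' = q) :=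
    fun p' => ⟨fun h => Plaq.shift_injective dirCorner (h.trans hQ), fun h => by rw [h]⟩
  have hiffp : ∀ p' : Plaq 4, (Plaq.shift dirCorner p' = P) ↔ (p' = p) :=
    fun p' => ⟨fun h => Plaq.shift_injective dirCorner (h.trans hP), fun h => by rw [h]⟩
  have hδq : ∀ p' ∈ plaquettesIn (halfOpenBox 4 n), (if p' = q then (1 : ℝ) else 0) =
      coeff pin dirCorner n (Plaq.shift dirCorner p') ⬝ᵥ sq +
        div₃ (fun y a b c => χ y * d₂ (greenTensor Q) y a b c)
          (Plaq.shift dirCorner p').1 (Plaq.shift dirCorner p').2.1 (Plaq.shift dirCorner p').2.2 +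
        (d₁ (fun x i => (1 - χ x) * div₂ (greenTensor Q) x i)
            (Plaq.shift dirCorner p').1 (Plaq.shift dirCorner p').2.1 (Plaq.shift dirCorner p').2.2 +
          div₃ (fun y a b c => (1 - χ y) * d₂ (greenTensor Q) y a b c)
            (Plaq.shift dirCorner p').1 (Plaq.shift dirCorner p').2.1 (Plaq.shift dirCorner p').2.2) := by
    intro p' hp'
    rw [hsq]
    have hor : (Plaq.shift dirCorner p').2.1 < (Plaq.shift dirCorner p').2.2 := (Plaq.mem_plaquettesIn.1 hp').2.1
    have h := pointMass_eq_dir_split hqor hor χ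
    simp only [hiffq] at h
    exact h
  have hδp : ∀ p' ∈ plaquettesIn (halfOpenBox 4 n), (if p' = p then (1 : ℝ) else 0) =
      coeff pin dirCorner n (Plaq.shift dirCorner p') ⬝ᵥ sp +
        div₃ (fun y a b c => χ y * d₂ (greenTensor P) y a b c)
          (Plaq.shift dirCorner p').1 (Plaq.shift dirCorner p').2.1 (Plaq.shift dirCorner p').2.2 +
        (d₁ (fun x i => (1 - χ x) * div₂ (greenTensor P) x i)
            (Plaq.shift dirCorner p').1 (Plaq.shift dirCorner p').2.1 (Plaq.shift dirCorner p').2.2 +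
          div₃ (fun y a b c => (1 - χ y) * d₂ (greenTensor P) y a b c)
            (Plaq.shift dirCorner p').1 (Plaq.shift dirCorner p').2.1 (Plaq.shift dirCorner p').2.2) := by
    intro p' hp'
    rw [hsp]
    have hor : (Plaq.shift dirCorner p').2.1 < (Plaq.shift dirCorner p').2.2 := (Plaq.mem_plaquettesIn.1 hp').2.1
    have h := pointMass_eq_dir_split hpor hor χ
    simp only [hiffp] at h
    exact h
  have hann : ∀ (x : Plaq 4) (s : LatticeMaxwell.Free pin dirCorner n → ℝ), ∑ p' ∈ plaquettesIn (halfOpenBox 4 n),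
      div₃ (fun y a b c => χ y * d₂ (greenTensor x) y a b c)
        (Plaq.shift dirCorner p').1 (Plaq.shift dirCorner p').2.1 (Plaq.shift dirCorner p').2.2 *
        (coeff pin dirCorner n (Plaq.shift dirCorner p') ⬝ᵥ s) = 0 := fun x s =>
    sum_div₃_mul_coeff_shift_eq_zero (m := 2 * H + 1) (isAltR₃_smul_site χ (isAltR₃_d₂_greenTensor x))
      (hasFiniteSupport_smul_site hχ _) (fun y a b c h => hχ y (left_ne_zero_of_mul h))
      (plaquettesIn_cold_subset_enlarged H) s
  have hmain := abs_gramKernel_sub_le (dirQmat_eq_sum H) (posDef_dirQmat H) hK hp hq hδq hδp (hann Q) (hann P)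
  have hsum : ∑ p' ∈ plaquettesIn (halfOpenBox 4 n),
      |coeff pin dirCorner n (Plaq.shift dirCorner p') ⬝ᵥ sp| *
        |d₁ (fun x i => (1 - χ x) * div₂ (greenTensor Q) x i)
            (Plaq.shift dirCorner p').1 (Plaq.shift dirCorner p').2.1 (Plaq.shift dirCorner p').2.2 +
          div₃ (fun y a b c => (1 - χ y) * d₂ (greenTensor Q) y a b c)
            (Plaq.shift dirCorner p').1 (Plaq.shift dirCorner p').2.1 (Plaq.shift dirCorner p').2.2| =
      ∑ p' ∈ plaquettesIn (halfOpenBox 4 n),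
        |d₁ (fun x i => χ x * div₂ (greenTensor P) x i)
            (Plaq.shift dirCorner p').1 (Plaq.shift dirCorner p').2.1 (Plaq.shift dirCorner p').2.2| *
          |d₁ (fun x i => (1 - χ x) * div₂ (greenTensor Q) x i)
              (Plaq.shift dirCorner p').1 (Plaq.shift dirCorner p').2.1 (Plaq.shift dirCorner p').2.2 +
            div₃ (fun y a b c => (1 - χ y) * d₂ (greenTensor Q) y a b c)
              (Plaq.shift dirCorner p').1 (Plaq.shift dirCorner p').2.1 (Plaq.shift dirCorner p').2.2| :=
    Finset.sum_congr rfl fun p' _ => by rw [hsp]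
  rw [hsq P, hsum] at hmain
  exact hmain

end Summit.QuantumFields.YangMills.Theorems.WeakCouplingRates

end
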